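import Summits.Ventures.LatticeQCDFlow.Exactness.ReversibleAbelFloors
import Summits.Ventures.LatticeQCDFlow.Exactness.Phi4HMCMagnetisationTunnelling
import HarnessLib

/-!
# The `Z₂` TUNNELLING floors in ABEL FORM, free of the summability hypothesis: `Σ_k ρ_{sgn M}(Vk) rᵏ ≥ 1/((1 − r) + r V π(|M| ≤ δ))` (local arm), `≥ 1/((1 − r) + 2 r · r_sign)` (HMC)

HONEST FRAMING: exact (Metropolis-corrected) sampling algorithms for lattice gauge theory;
figures of merit are autocorrelation/cost numbers at stated couplings and volumes; no
continuum-physics claim.  (SCALAR calibration rung S0-A: not a gauge result.)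

Venture `LatticeQCDFlow` (cell pub-lqcd), topic `Exactness`; FANOUT row 2 (`s0-phi4`).  NEW WORK of
the cell: lattice instances of `Exactness/ReversibleAbelFloors.lean`
(`RevOp.thinned_abelSum_autocorr_ge_of_integral_carre_le`) for gen-16's tunnelling floors of the
`Z₂` order parameter `sgn M` (`Phi4MetropolisSignTunnellingCSD`: the strip a proposal can cross;
`Phi4PhaseLabelFlipRate(HMCFlow)`: the rate of accepted sign changes), now as bounds on the ABEL SUMS
of the sweep-thinned / per-trajectory autocorrelation function of `sgn M`, valid for every `r < 1`
with NO summability and NO `ρ < 1` hypothesis.  Nothing is cited as a fact.  (`⟨(sgn M)²⟩ = 1`,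
`⟨sgn M⟩ = 0` by `Z₂`; the autocorrelation below is that of `sgn M` itself, `ρ(j) = C(j)/Z`.)

## What is proved (`Λ = Fin (n+1)`, `V = n+1`, every `λ > 0`, real `J`, `0 ≤ r < 1`)

* **`metropolisScan_abelSum_signM_ge_strip`** — LOCAL arm, window step density (`ρ` even, `= 0`
  off `[−δ, δ]`): **`Σ_{k≥0} ρ_{sgn M}(Vk) rᵏ ≥ 1 / ((1 − r) + r V π(|M| ≤ δ))`**;
* **`metropolisScan_abelSum_signM_ge_flipRate`** — LOCAL arm, every even step density:
  `Σ_{k≥0} ρ_{sgn M}(Vk) rᵏ ≥ 1 / ((1 − r) + 2 r V ⟨r_sign⟩)`, `V⟨r_sign⟩` = mean number of accepted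
  sign changes per sweep;
* **`hmcPhi4_abelSum_signM_ge_flipRate`** — row 2's HMC (qpq, every `δ`, `N`):
  `Σ_{k≥0} ρ_{sgn M}(k) rᵏ ≥ 1 / ((1 − r) + 2 r · r_sign)`, `r_sign` the probability per trajectory of
  an accepted sign change.

Reading: as `r ↑ 1` the bounds tend to `1/(V π(|M| ≤ δ))`, `1/(2V⟨r_sign⟩)`, `1/(2 r_sign)` — gen-16's
floors `+ ½`; so in the two-peak regime EITHER the autocorrelation series of `sgn M` diverges OR
`τ_int,sweep(sgn M) ≥ 1/(V π(|M| ≤ δ)) − ½` etc. (`ReversibleAbelFloors.tauInt_ge_of_abelSum_ge` /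
`not_summable_of_abelSum_unbounded`): the exponential tunnelling floor no longer presupposes a finite
`τ_int`.  NOT CLAIMED: any value of `π(|M| ≤ δ)` / `r_sign` for a run; the ordered sweep.
-/

namespace Summit.Ventures.LatticeQCDFlow.Exactness

open Real MeasureTheory Filter Finset
open Summit.Ventures.LatticeQCDFlow.Scoring

section TunnellingAbel

variable {n : ℕ}

/-- `∫ (sgn M)² e^{−S} = Z`. -/
theorem integral_signM_sq_mul_gibbsWeight (J : Fin (n + 1) → Fin (n + 1) → ℝ) (lam : ℝ) :
    ∫ φ : Fin (n + 1) → ℝ, (if 0 ≤ ∑ x, φ x then (1 : ℝ) else -1) ^ 2 * gibbsWeight J lam φ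
      = gibbsZ J lam := by
  unfold gibbsZ
  refine integral_congr_ae (Eventually.of_forall fun φ => ?_)
  show (if 0 ≤ ∑ x, φ x then (1 : ℝ) else -1) ^ 2 * gibbsWeight J lam φ = gibbsWeight J lam φ
  split_ifs <;> ring

/-- **THE `Z₂` TUNNELLING FLOOR OF THE LOCAL ARM IN ABEL FORM (window step law, unconditional).**
`ρ` an even probability density vanishing outside `[−δ, δ]`, `K` the random-site-scan Metropolis
operator, `V = n+1`; for every `0 ≤ r < 1`:
`Σ_{k≥0} ρ_{sgn M}((n+1)k) rᵏ ≥ 1 / ((1 − r) + r (n+1) π(|M| ≤ δ))`. -/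
theorem metropolisScan_abelSum_signM_ge_strip {lam : ℝ} (hlam : 0 < lam)
    (J : Fin (n + 1) → Fin (n + 1) → ℝ) {ρ : ℝ → ℝ} (hρ0 : ∀ u, 0 ≤ ρ u) (hρm : Measurable ρ)
    (hρi : Integrable ρ) (hρ1 : ∫ u, ρ u = 1) (hρs : ∀ u, ρ (-u) = ρ u) {δ : ℝ}
    (hρδ : ∀ u, δ < |u| → ρ u = 0) {r : ℝ} (hr0 : 0 ≤ r) (hr1 : r < 1) :
    1 / ((1 - r) + r * (((n : ℝ) + 1) * gibbsExpect J lam (fun φ => if |∑ y, φ y| ≤ δ then (1 : ℝ) else 0)))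
      ≤ ∑' k, (∫ φ, (if 0 ≤ ∑ x, φ x then (1 : ℝ) else -1)
          * ((metroScan J lam ρ)^[(n + 1) * k] (fun ψ => if 0 ≤ ∑ x, ψ x then (1 : ℝ) else -1)) φ
          * gibbsWeight J lam φ)
          / (∫ φ, (if 0 ≤ ∑ x, φ x then (1 : ℝ) else -1) ^ 2 * gibbsWeight J lam φ) * r ^ k := by
  have hco := latticePhi4Action_coercive hlam J
  have hZ := gibbsZ_pos hlam J
  have hw := integrable_gibbsWeight hlam J
  have hMm : Measurable fun φ : Fin (n + 1) → ℝ => ∑ y, φ y :=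
    Finset.measurable_sum _ fun y _ => measurable_pi_apply y
  have hθ : BddObs (fun φ : Fin (n + 1) → ℝ => if 0 ≤ ∑ x, φ x then (1 : ℝ) else -1) :=
    label_bddObs hMm 0
  -- strip indicator
  have hSm : Measurable (fun φ : Fin (n + 1) → ℝ => if |∑ y, φ y| ≤ δ then (1 : ℝ) else 0) :=
    Measurable.ite (measurableSet_le hMm.abs measurable_const) measurable_const measurable_const
  have hSb : ∀ φ : Fin (n + 1) → ℝ, |(if |∑ y, φ y| ≤ δ then (1 : ℝ) else 0)| ≤ 1 := fun φ => by
    split_ifs <;> norm_num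
  have hSi : Integrable (fun φ : Fin (n + 1) → ℝ =>
      (if |∑ y, φ y| ≤ δ then (1 : ℝ) else 0) * gibbsWeight J lam φ) :=
    integrable_bdd_mul_weight (μ := volume) hSm hSb (continuous_gibbsWeight J lam).measurable
      (fun φ => (gibbsWeight_pos J lam φ).le) hw
  have hΓ : ∫ φ, metroScan J lam ρ (fun ψ => ((if 0 ≤ ∑ y, ψ y then (1 : ℝ) else -1)
        - (if 0 ≤ ∑ y, φ y then (1 : ℝ) else -1)) ^ 2) φ * gibbsWeight J lam φ
      ≤ 2 * ∫ φ, (if |∑ y, φ y| ≤ δ then (1 : ℝ) else 0) * gibbsWeight J lam φ := by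
    refine (integral_metroScan_signDev_le hlam J hρ0 hρm hρi hρ1 hρs).trans ?_
    refine mul_le_mul_of_nonneg_left ?_ (by norm_num)
    refine integral_mono_of_nonneg (Eventually.of_forall fun φ =>
      mul_nonneg (reach_mem_Icc hρ0 hρi hρ1 (fun φ : Fin (n + 1) → ℝ => ∑ y, φ y) 0 1 φ).1
        (gibbsWeight_pos J lam φ).le) hSi (Eventually.of_forall fun φ => ?_)
    have hr := reach_le_strip hρ0 hρi hρ1 hρδ zero_le_one (fun φ : Fin (n + 1) → ℝ => ∑ y, φ y) 0 φ
    have e : (if |(∑ y, φ y) - 0| ≤ 1 * δ then (1 : ℝ) else 0)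
        = (if |∑ y, φ y| ≤ δ then (1 : ℝ) else 0) := by rw [sub_zero, one_mul]
    rw [e] at hr
    exact mul_le_mul_of_nonneg_right hr (gibbsWeight_pos J lam φ).le
  have hP : 0 < ∫ φ : Fin (n + 1) → ℝ, (if 0 ≤ ∑ x, φ x then (1 : ℝ) else -1) ^ 2 * gibbsWeight J lam φ := by
    rw [integral_signM_sq_mul_gibbsWeight]; exact hZ
  have h := RevOp.thinned_abelSum_autocorr_ge_of_integral_carre_le (μ := volume) (A := BddObs)
    (K := metroScan J lam ρ) (w := gibbsWeight J lam)
    (fun φ => (gibbsWeight_pos J lam φ).le) (bddObs_const 1)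
    (fun f h hf hh => bddObs_integrable_mul_mul_gibbsWeight one_pos hco hf hh)
    (fun f h c hf hh => bddObs_add_mul hf hh c)
    (fun f hf => bddObs_metroScan J lam hρ0 hρm hρi hρ1 hf)
    (fun f h c hf hh x => metroScan_add_mul J lam hρ0 hρm hρi hf hh c x)
    (fun f h hf hh => metroScan_reversible one_pos hco hρ0 hρm hρi hρ1 hρs hf hh)
    (fun f hf => metroScan_contraction one_pos hco hρ0 hρm hρi hρ1 hρs hf)
    (fun φ => metroScan_one J lam hρ1 φ) hθ (bddObs_sq hθ) hP hΓ (n + 1) hr0 hr1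
  refine le_trans (le_of_eq ?_) h
  rw [integral_signM_sq_mul_gibbsWeight]
  unfold gibbsExpect
  congr 1
  congr 1
  congr 1
  push_cast
  field_simp

/-- **THE SIGN-FLIP FLOOR OF THE LOCAL ARM IN ABEL FORM (every even step density, unconditional).**
`r_sign(φ) = K[χ_sign flip(·, φ)](φ)`; for every `0 ≤ r < 1`:
`Σ_{k≥0} ρ_{sgn M}((n+1)k) rᵏ ≥ 1 / ((1 − r) + 2 r (n+1) ⟨r_sign⟩)`. -/
theorem metropolisScan_abelSum_signM_ge_flipRate {lam : ℝ} (hlam : 0 < lam)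
    (J : Fin (n + 1) → Fin (n + 1) → ℝ) {ρ : ℝ → ℝ} (hρ0 : ∀ u, 0 ≤ ρ u) (hρm : Measurable ρ)
    (hρi : Integrable ρ) (hρ1 : ∫ u, ρ u = 1) (hρs : ∀ u, ρ (-u) = ρ u) {r : ℝ} (hr0 : 0 ≤ r)
    (hr1 : r < 1) :
    1 / ((1 - r) + r * (2 * ((n : ℝ) + 1) * gibbsExpect J lam (fun φ =>
        metroScan J lam ρ (fun ψ => if (0 ≤ ∑ y, ψ y ↔ 0 ≤ ∑ y, φ y) then (0 : ℝ) else 1) φ)))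
      ≤ ∑' k, (∫ φ, (if 0 ≤ ∑ x, φ x then (1 : ℝ) else -1)
          * ((metroScan J lam ρ)^[(n + 1) * k] (fun ψ => if 0 ≤ ∑ x, ψ x then (1 : ℝ) else -1)) φ
          * gibbsWeight J lam φ)
          / (∫ φ, (if 0 ≤ ∑ x, φ x then (1 : ℝ) else -1) ^ 2 * gibbsWeight J lam φ) * r ^ k := by
  have hco := latticePhi4Action_coercive hlam J
  have hZ := gibbsZ_pos hlam J
  have hMm : Measurable fun φ : Fin (n + 1) → ℝ => ∑ y, φ y :=
    Finset.measurable_sum _ fun y _ => measurable_pi_apply y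
  have hθ : BddObs (fun φ : Fin (n + 1) → ℝ => if 0 ≤ ∑ x, φ x then (1 : ℝ) else -1) :=
    label_bddObs hMm 0
  have hΓ : ∫ φ, metroScan J lam ρ (fun ψ => ((if 0 ≤ ∑ y, ψ y then (1 : ℝ) else -1)
        - (if 0 ≤ ∑ y, φ y then (1 : ℝ) else -1)) ^ 2) φ * gibbsWeight J lam φ
      ≤ 4 * ∫ φ, metroScan J lam ρ (fun ψ => if (0 ≤ ∑ y, ψ y ↔ 0 ≤ ∑ y, φ y) then (0 : ℝ) else 1) φ
        * gibbsWeight J lam φ := by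
    refine le_of_eq ?_
    rw [← integral_const_mul]
    refine integral_congr_ae (Eventually.of_forall fun φ => ?_)
    show metroScan J lam ρ (fun ψ => ((if 0 ≤ ∑ y, ψ y then (1 : ℝ) else -1)
        - (if 0 ≤ ∑ y, φ y then (1 : ℝ) else -1)) ^ 2) φ * gibbsWeight J lam φ
      = 4 * (metroScan J lam ρ (fun ψ => if (0 ≤ ∑ y, ψ y ↔ 0 ≤ ∑ y, φ y) then (0 : ℝ) else 1) φ
        * gibbsWeight J lam φ)
    have h := metroScan_labelDev_eq_flip J lam ρ (fun φ : Fin (n + 1) → ℝ => ∑ y, φ y) 0 0 φ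
    simp only [sub_zero] at h
    rw [h, mul_assoc]
  have hP : 0 < ∫ φ : Fin (n + 1) → ℝ, (if 0 ≤ ∑ x, φ x then (1 : ℝ) else -1) ^ 2 * gibbsWeight J lam φ := by
    rw [integral_signM_sq_mul_gibbsWeight]; exact hZ
  have h := RevOp.thinned_abelSum_autocorr_ge_of_integral_carre_le (μ := volume) (A := BddObs)
    (K := metroScan J lam ρ) (w := gibbsWeight J lam)
    (fun φ => (gibbsWeight_pos J lam φ).le) (bddObs_const 1)
    (fun f h hf hh => bddObs_integrable_mul_mul_gibbsWeight one_pos hco hf hh)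
    (fun f h c hf hh => bddObs_add_mul hf hh c)
    (fun f hf => bddObs_metroScan J lam hρ0 hρm hρi hρ1 hf)
    (fun f h c hf hh x => metroScan_add_mul J lam hρ0 hρm hρi hf hh c x)
    (fun f h hf hh => metroScan_reversible one_pos hco hρ0 hρm hρi hρ1 hρs hf hh)
    (fun f hf => metroScan_contraction one_pos hco hρ0 hρm hρi hρ1 hρs hf)
    (fun φ => metroScan_one J lam hρ1 φ) hθ (bddObs_sq hθ) hP hΓ (n + 1) hr0 hr1
  refine le_trans (le_of_eq ?_) h
  rw [integral_signM_sq_mul_gibbsWeight]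
  unfold gibbsExpect
  congr 1
  congr 1
  congr 1
  push_cast
  field_simp
  ring

/-- **THE SIGN-FLIP FLOOR OF ROW 2's HMC IN ABEL FORM (every `δ`, `N`; unconditional).**
`r_sign = ∫∫ a χ_sign flip e^{−H}/(Z_p Z)` the probability per trajectory of an accepted sign change;
for every `0 ≤ r < 1`:  `Σ_{k≥0} ρ_{sgn M}(k) rᵏ ≥ 1 / ((1 − r) + 2 r · r_sign)`. -/
theorem hmcPhi4_abelSum_signM_ge_flipRate {lam : ℝ} (hlam : 0 < lam)
    (J : Fin (n + 1) → Fin (n + 1) → ℝ) (δ : ℝ) (N : ℕ) {r : ℝ} (hr0 : 0 ≤ r) (hr1 : r < 1) :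
    1 / ((1 - r) + r * (2 * ((∫ z, involAccept (phi4HmcEnergy J lam) (hmcProposal J lam δ N) z
            * (if (0 ≤ ∑ x, (hmcProposal J lam δ N z).1 x ↔ 0 ≤ ∑ x, z.1 x) then (0 : ℝ) else 1)
            * Real.exp (-phi4HmcEnergy J lam z) ∂((volume : Measure (Fin (n + 1) → ℝ)).prod volume))
          / (momentumZ n * gibbsZ J lam))))
      ≤ ∑' k, (∫ φ, (if 0 ≤ ∑ x, φ x then (1 : ℝ) else -1)
          * ((hmcOpPhi4 J lam δ N)^[k] (fun ψ => if 0 ≤ ∑ x, ψ x then (1 : ℝ) else -1)) φ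
          * gibbsWeight J lam φ)
          / (∫ φ, (if 0 ≤ ∑ x, φ x then (1 : ℝ) else -1) ^ 2 * gibbsWeight J lam φ) * r ^ k := by
  have hco := latticePhi4Action_coercive hlam J
  have hZ := gibbsZ_pos hlam J
  have hZp := momentumZ_pos n
  obtain ⟨C, hC1, hCg⟩ := hmcProposal_growth J lam δ N
  have hC : 0 ≤ C := zero_le_one.trans hC1
  have hΨm := measurable_hmcProposal (Λ := Fin (n + 1)) J lam δ N
  have hΨi := hmcProposal_involutive (Λ := Fin (n + 1)) J lam δ N
  have hΨμ := measurePreserving_hmcProposal (Λ := Fin (n + 1)) J lam δ N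
  have hMm : Measurable fun φ : Fin (n + 1) → ℝ => ∑ y, φ y :=
    Finset.measurable_sum _ fun y _ => measurable_pi_apply y
  have hθ : PolyObs (fun φ : Fin (n + 1) → ℝ => if 0 ≤ ∑ x, φ x then (1 : ℝ) else -1) :=
    polyObs_of_bddObs (label_bddObs hMm 0)
  set I := ∫ z, involAccept (phi4HmcEnergy J lam) (hmcProposal J lam δ N) z
      * (if (0 ≤ ∑ x, (hmcProposal J lam δ N z).1 x ↔ 0 ≤ ∑ x, z.1 x) then (0 : ℝ) else 1)
      * Real.exp (-phi4HmcEnergy J lam z) ∂((volume : Measure (Fin (n + 1) → ℝ)).prod volume) with hI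
  have hΓ : ∫ φ, hmcOpOf J lam (hmcProposal J lam δ N) (fun ψ => ((if 0 ≤ ∑ x, ψ x then (1 : ℝ) else -1)
      - (if 0 ≤ ∑ x, φ x then (1 : ℝ) else -1)) ^ 2) φ * gibbsWeight J lam φ ≤ 4 * I / momentumZ n := by
    rw [integral_hmcOpOf_sq_dev_eq_poly one_pos hco hΨm hΨμ hθ, hI, ← integral_const_mul]
    refine le_of_eq ?_
    congr 1
    refine integral_congr_ae (Eventually.of_forall fun z => ?_)
    show involAccept (phi4HmcEnergy J lam) (hmcProposal J lam δ N) z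
        * ((if 0 ≤ ∑ x, (hmcProposal J lam δ N z).1 x then (1 : ℝ) else -1)
          - (if 0 ≤ ∑ x, z.1 x then (1 : ℝ) else -1)) ^ 2
        * Real.exp (-phi4HmcEnergy J lam z)
      = 4 * (involAccept (phi4HmcEnergy J lam) (hmcProposal J lam δ N) z
        * (if (0 ≤ ∑ x, (hmcProposal J lam δ N z).1 x ↔ 0 ≤ ∑ x, z.1 x) then (0 : ℝ) else 1)
        * Real.exp (-phi4HmcEnergy J lam z))
    rw [label_sq_sub_eq_four_mul_flip]
    ring
  have hP : 0 < ∫ φ : Fin (n + 1) → ℝ, (if 0 ≤ ∑ x, φ x then (1 : ℝ) else -1) ^ 2 * gibbsWeight J lam φ := by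
    rw [integral_signM_sq_mul_gibbsWeight]; exact hZ
  have h := RevOp.thinned_abelSum_autocorr_ge_of_integral_carre_le (μ := volume) (A := PolyObs)
    (K := hmcOpOf J lam (hmcProposal J lam δ N)) (w := gibbsWeight J lam)
    (fun φ => (gibbsWeight_pos J lam φ).le) (polyObs_const 1)
    (fun f h hf hh => polyObs_integrable_mul_mul_gibbsWeight one_pos hco hf hh)
    (fun f h c hf hh => polyObs_add_mul hf hh c)
    (fun f hf => polyObs_hmcOpOf J lam hΨm hC hCg hf)
    (fun f h c hf hh x => hmcOpOf_add_mul_poly J lam hΨm hC hCg hf hh c x)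
    (fun f h hf hh => hmc_reversible_poly one_pos hco hΨm hΨi hΨμ hf hh)
    (fun f hf => hmcOpOf_contraction_poly one_pos hco hΨm hΨi hΨμ hC hCg hf)
    (fun φ => hmcOpOf_one J lam _ φ) hθ (polyObs_sq hθ) hP hΓ 1 hr0 hr1
  simp only [one_mul, Nat.cast_one] at h
  refine le_trans (le_of_eq ?_) h
  rw [integral_signM_sq_mul_gibbsWeight]
  congr 1
  congr 1
  congr 1
  field_simp
  ring

end TunnellingAbel

end Summit.Ventures.LatticeQCDFlow.Exactness
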